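import Summits.Ventures.HodgeRepro2.PicardExists
import Summits.Ventures.HodgeRepro2.AntidiagonalInvolution
import Summits.Ventures.HodgeRepro2.DefiniteAnisotropic
import Summits.Ventures.HodgeRepro2.AtkinLehnerEigenvalues

/-!
# DiagonalPicardInvolutions — the record's ANISOTROPIC Picard forms `diag(1, 1, a)` (rows 3–4) carry the explicit
Atkin–Lehner involution `w = diag(−1, 1, −1)`: it normalises every `Γ_N` of a coordinate lattice and acts on the
weight-`k` forms as a single slash with `T_w² = id` and eigenvalues `±1` (p2 annex row 168)

Cell pub-hodge-repro2, Tier 5 kernel annex (seat p2, Shimura-data / Hecke side). Proof lane (no new definition).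
§8(d): uses an L-value-free non-vanishing device: NO.

The compact-quotient counterpart of the quasi-split rows 154 / 161 / 163: the Picard forms of the record are the
DIAGONAL forms `H_a = diag(1, 1, a)`, `a ∈ K⁺` (row 4's `picardHermitianFormExists` builds one), and
* `isPicardSignature_diagonal_one_one` — `H_a` has the Picard signature iff the real number `a` is negative at
  the real place of `K⁺` below `τ₁` and positive at the other real places (`signatureAt_eq_of_map_eq_diagonal`,
  row 4); by row 152 such an `H_a` is ANISOTROPIC for `[K : ℚ] > 2` (`isAnisotropic_diagonal_one_one`) — the
  form whose arithmetic quotients are the compact Picard modular surfaces (Godement; prose).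
* `signInvolutionGL_mem_specialUnitaryGroup_diagonal` — `w = diag(−1, 1, −1) ∈ SU(H_a)(K)`; it stabilises every
  coordinate lattice (row 154), hence NORMALISES every `Γ_N` (`signInvolutionGL_normalizes_shimuraLevel_diagonal`,
  row 153), and on the weight-`k` forms for `Γ_N`: `T_w f = f∥w`, `T_w T_w f = f` on the ball
  (`hecke_signInvolution_diagonal`); on the Petersson space of `Γ_N` (compact quotient): `T_w ∘ T_w = id` and every
  eigenvalue of `T_w` is `±1` (`heckeFamilyOf_signInvolution_eigenvalue_diagonal`, row 148).
These are the Atkin–Lehner involutions available on the record's datum itself; the multi-coset involutions of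
row 161 were exhibited on the quasi-split model only.

No `sorry`; `#print axioms` ⊆ {propext, Classical.choice, Quot.sound}.
-/

namespace Summit.Ventures.HodgeRepro2.ShimuraData

open Matrix

variable {K : Type*} [Field K] [NumberField K] [NumberField.IsCMField K]

/-- `τ(H_a) = diag(1, 1, Re τ(a))` — the entries are real. -/
theorem map_diagonal_one_one_eq (τ : K →+* ℂ) (a : NumberField.maximalRealSubfield K) :
    (Matrix.diagonal ![1, 1, (algebraMap (NumberField.maximalRealSubfield K) K) a]).map τ = Matrix.diagonal (fun i =>
      ((![1, 1, (((NumberField.IsCMField.equivInfinitePlace K) (NumberField.InfinitePlace.mk τ)).embedding a).re]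
        : Fin 3 → ℝ) i : ℂ)) := by
  rw [Matrix.diagonal_map (map_zero τ)]
  congr 1
  ext i
  fin_cases i <;> simp [embedding_algebraMap_eq_re]

/-- The signature of `H_a` at `τ` is `(2, 1)` when `a` is negative at the real place below `τ`. -/
theorem signatureAt_diagonal_one_one_of_neg (τ : K →+* ℂ) (a : NumberField.maximalRealSubfield K)
    (ha : (((NumberField.IsCMField.equivInfinitePlace K) (NumberField.InfinitePlace.mk τ)).embedding a).re < 0) :
    signatureAt K τ (Matrix.diagonal ![1, 1, (algebraMap (NumberField.maximalRealSubfield K) K) a]) = (2, 1) := by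
  rw [signatureAt_eq_of_map_eq_diagonal K (isHermitianForm_diagonal_one_one K a) τ _
    (map_diagonal_one_one_eq τ a)]
  generalize hr : (((NumberField.IsCMField.equivInfinitePlace K) (NumberField.InfinitePlace.mk τ)).embedding a).re
    = r at ha ⊢
  have h1 : ({i | 0 < (![1, 1, r] : Fin 3 → ℝ) i} : Finset (Fin 3)) = {0, 1} := by
    ext i; fin_cases i <;> simp [not_lt.mpr ha.le]
  have h2 : ({i | (![1, 1, r] : Fin 3 → ℝ) i < 0} : Finset (Fin 3)) = {2} := by
    ext i; fin_cases i <;> simp [ha]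
  rw [h1, h2]
  rfl

/-- The signature of `H_a` at `τ` is `(3, 0)` — `H_a` is definite at `τ` — when `a` is positive at the real place
below `τ`. -/
theorem isDefiniteAt_diagonal_one_one_of_pos (τ : K →+* ℂ) (a : NumberField.maximalRealSubfield K)
    (ha : 0 < (((NumberField.IsCMField.equivInfinitePlace K) (NumberField.InfinitePlace.mk τ)).embedding a).re) :
    IsDefiniteAt K τ (Matrix.diagonal ![1, 1, (algebraMap (NumberField.maximalRealSubfield K) K) a]) := by
  left
  rw [signatureAt_eq_of_map_eq_diagonal K (isHermitianForm_diagonal_one_one K a) τ _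
    (map_diagonal_one_one_eq τ a)]
  generalize hr : (((NumberField.IsCMField.equivInfinitePlace K) (NumberField.InfinitePlace.mk τ)).embedding a).re
    = r at ha ⊢
  have h1 : ({i | 0 < (![1, 1, r] : Fin 3 → ℝ) i} : Finset (Fin 3)) = Finset.univ := by
    ext i; fin_cases i <;> simp [ha]
  have h2 : ({i | (![1, 1, r] : Fin 3 → ℝ) i < 0} : Finset (Fin 3)) = ∅ := by
    ext i; fin_cases i <;> simp [not_lt.mpr ha.le]
  rw [h1, h2]
  rfl

/-- THE PICARD-SIGNATURE CRITERION for `H_a = diag(1, 1, a)`: `a` negative at the real place below `τ₁` and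
positive at every other real place of `K⁺`. -/
theorem isPicardSignature_diagonal_one_one (τ₁ : K →+* ℂ) (a : NumberField.maximalRealSubfield K)
    (hneg : (((NumberField.IsCMField.equivInfinitePlace K) (NumberField.InfinitePlace.mk τ₁)).embedding a).re < 0)
    (hpos : ∀ τ : K →+* ℂ, NumberField.InfinitePlace.mk τ ≠ NumberField.InfinitePlace.mk τ₁ →
      0 < (((NumberField.IsCMField.equivInfinitePlace K) (NumberField.InfinitePlace.mk τ)).embedding a).re) :
    IsPicardSignature K τ₁ (Matrix.diagonal ![1, 1, (algebraMap (NumberField.maximalRealSubfield K) K) a]) :=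
  ⟨signatureAt_diagonal_one_one_of_neg τ₁ a hneg,
    fun τ hτ => isDefiniteAt_diagonal_one_one_of_pos τ a (hpos τ hτ)⟩

/-- For `[K : ℚ] > 2` the Picard form `H_a` is ANISOTROPIC (row 152): the datum of the compact Picard modular
surfaces. -/
theorem isAnisotropic_diagonal_one_one (τ₁ : K →+* ℂ) (a : NumberField.maximalRealSubfield K)
    (hpos : ∀ τ : K →+* ℂ, NumberField.InfinitePlace.mk τ ≠ NumberField.InfinitePlace.mk τ₁ →
      0 < (((NumberField.IsCMField.equivInfinitePlace K) (NumberField.InfinitePlace.mk τ)).embedding a).re)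
    (hK : 2 < Module.finrank ℚ K) : IsAnisotropic (Matrix.diagonal ![1, 1, (algebraMap (NumberField.maximalRealSubfield K) K) a]) :=
  isAnisotropic_of_two_lt_finrank (isHermitianForm_diagonal_one_one K a)
    (fun τ hτ => isDefiniteAt_diagonal_one_one_of_pos τ a (hpos τ hτ)) hK

/-- `w = diag(−1, 1, −1)` is `H_a`-unitary (diagonal matrices commute, `(−1)² = 1`). -/
theorem signInvolutionGL_mem_unitaryGroup_diagonal (a : NumberField.maximalRealSubfield K) :
    (signInvolutionGL : GL (Fin 3) K) ∈ unitaryGroup K (Matrix.diagonal ![1, 1, (algebraMap (NumberField.maximalRealSubfield K) K) a]) := by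
  show conjTransposeK K (signInvolutionGL : GL (Fin 3) K).val * _ * (signInvolutionGL : GL (Fin 3) K).val = _
  rw [coe_signInvolutionGL]
  ext i j
  fin_cases i <;> fin_cases j <;>
    simp [conjTransposeK, signInvolution, Matrix.mul_apply, Matrix.diagonal, Matrix.transpose_apply,
      Matrix.map_apply]

/-- `w ∈ SU(H_a)(K)`. -/
theorem signInvolutionGL_mem_specialUnitaryGroup_diagonal (a : NumberField.maximalRealSubfield K) :
    (signInvolutionGL : GL (Fin 3) K) ∈ specialUnitaryGroup K (Matrix.diagonal ![1, 1, (algebraMap (NumberField.maximalRealSubfield K) K) a]) := by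
  refine Subgroup.mem_inf.mpr ⟨signInvolutionGL_mem_unitaryGroup_diagonal a, ?_⟩
  rw [MonoidHom.mem_ker]
  ext
  simp [coe_signInvolutionGL, signInvolution, Matrix.det_diagonal, Fin.prod_univ_three]

/-- `w` normalises every `Γ_N` of `H_a` for a coordinate lattice (row 154's lattice stability + row 153). -/
theorem signInvolutionGL_normalizes_shimuraLevel_diagonal (a : NumberField.maximalRealSubfield K)
    {𝔪 : Submodule ℤ (Fin 3 → K)} (hcoord : ∀ x ∈ 𝔪, ∀ i : Fin 3, Pi.single i (x i) ∈ 𝔪) (N : ℕ)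
    (s : GL (Fin 3) K) :
    s ∈ shimuraLevelSubgroup K (Matrix.diagonal ![1, 1, (algebraMap (NumberField.maximalRealSubfield K) K) a]) 𝔪 N ↔
      (signInvolutionGL : GL (Fin 3) K) * s * signInvolutionGL⁻¹ ∈ shimuraLevelSubgroup K (Matrix.diagonal ![1, 1, (algebraMap (NumberField.maximalRealSubfield K) K) a]) 𝔪 N :=
  mem_shimuraLevel_conj_iff (signInvolutionGL_mem_unitaryGroup_diagonal a)
    (stabilizesLattice_signInvolutionGL hcoord) s

/-- On the weight-`k` forms for `Γ_N` of `H_a`: `T_w f = f∥w` and `T_w (T_w f) = f` on the ball (row 153). -/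
theorem hecke_signInvolution_diagonal {τ₁ : K →+* ℂ} {a : NumberField.maximalRealSubfield K}
    {Q : Matrix (Fin 3) (Fin 3) ℂ} (hQ : IsFrame K τ₁ (Matrix.diagonal ![1, 1, (algebraMap (NumberField.maximalRealSubfield K) K) a]) Q) {𝔪 : Submodule ℤ (Fin 3 → K)}
    (hcoord : ∀ x ∈ 𝔪, ∀ i : Fin 3, Pi.single i (x i) ∈ 𝔪) {N : ℕ}
    [Fintype (shimuraLevelSubgroup K (Matrix.diagonal ![1, 1, (algebraMap (NumberField.maximalRealSubfield K) K) a]) 𝔪 N ⧸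
      (heckeSubgroup (shimuraLevelSubgroup K (Matrix.diagonal ![1, 1, (algebraMap (NumberField.maximalRealSubfield K) K) a]) 𝔪 N) signInvolutionGL).subgroupOf
        (shimuraLevelSubgroup K (Matrix.diagonal ![1, 1, (algebraMap (NumberField.maximalRealSubfield K) K) a]) 𝔪 N))]
    {k : ℕ} {f : (Fin 2 → ℂ) → ℂ} (hf : IsWeightFor τ₁ Q (shimuraLevelSubgroup K (Matrix.diagonal ![1, 1, (algebraMap (NumberField.maximalRealSubfield K) K) a]) 𝔪 N) k f)
    {z : Fin 2 → ℂ} (hz : z ∈ ball₂) :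
    hecke (shimuraLevelSubgroup K (Matrix.diagonal ![1, 1, (algebraMap (NumberField.maximalRealSubfield K) K) a]) 𝔪 N) signInvolutionGL τ₁ Q k f z =
        slash k (realEmbedding K τ₁ Q signInvolutionGL) f z ∧
      hecke (shimuraLevelSubgroup K (Matrix.diagonal ![1, 1, (algebraMap (NumberField.maximalRealSubfield K) K) a]) 𝔪 N) signInvolutionGL τ₁ Q k
        (hecke (shimuraLevelSubgroup K (Matrix.diagonal ![1, 1, (algebraMap (NumberField.maximalRealSubfield K) K) a]) 𝔪 N) signInvolutionGL τ₁ Q k f) z = f z :=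
  ⟨hecke_eq_slash_of_stabilizesLattice hQ (signInvolutionGL_mem_unitaryGroup_diagonal a)
      (stabilizesLattice_signInvolutionGL hcoord) hf hz,
    hecke_hecke_eq_self_of_stabilizesLattice hQ (signInvolutionGL_mem_unitaryGroup_diagonal a)
      signInvolutionGL_mul_self (fun _ hx => vecMul_signInvolution_mem hcoord hx) hf hz⟩

/-- On the Petersson space of `Γ_N` of `H_a` (compact quotient, fundamental domain): `T_w ∘ T_w = id` and every
eigenvalue of `T_w` is `±1` (row 148). -/
theorem heckeFamilyOf_signInvolution_eigenvalue_diagonal {τ₁ : K →+* ℂ} {a : NumberField.maximalRealSubfield K}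
    {Q : Matrix (Fin 3) (Fin 3) ℂ} (hQ : IsFrame K τ₁ (Matrix.diagonal ![1, 1, (algebraMap (NumberField.maximalRealSubfield K) K) a]) Q) {𝔪 : Submodule ℤ (Fin 3 → K)}
    (hcoord : ∀ x ∈ 𝔪, ∀ i : Fin 3, Pi.single i (x i) ∈ 𝔪) (N : ℕ)
    [CompactSpace (ballQuotient hQ (shimuraLevelSubgroup K (Matrix.diagonal ![1, 1, (algebraMap (NumberField.maximalRealSubfield K) K) a]) 𝔪 N)
      (shimuraLevelSubgroup_subset_unitaryGroup (Matrix.diagonal ![1, 1, (algebraMap (NumberField.maximalRealSubfield K) K) a]) 𝔪 N))]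
    {D : Set ball₂} (k : ℕ)
    (hD : IsBallFundamentalDomain hQ (shimuraLevelSubgroup K (Matrix.diagonal ![1, 1, (algebraMap (NumberField.maximalRealSubfield K) K) a]) 𝔪 N)
      (shimuraLevelSubgroup_subset_unitaryGroup (Matrix.diagonal ![1, 1, (algebraMap (NumberField.maximalRealSubfield K) K) a]) 𝔪 N) D)
    (hDm : MeasurableSet D)
    (inst : ∀ δ : unitaryGroup K (Matrix.diagonal ![1, 1, (algebraMap (NumberField.maximalRealSubfield K) K) a]), Fintype (shimuraLevelSubgroup K (Matrix.diagonal ![1, 1, (algebraMap (NumberField.maximalRealSubfield K) K) a]) 𝔪 N ⧸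
      (heckeSubgroup (shimuraLevelSubgroup K (Matrix.diagonal ![1, 1, (algebraMap (NumberField.maximalRealSubfield K) K) a]) 𝔪 N) (δ : GL (Fin 3) K)).subgroupOf
        (shimuraLevelSubgroup K (Matrix.diagonal ![1, 1, (algebraMap (NumberField.maximalRealSubfield K) K) a]) 𝔪 N)))
    {w : unitaryGroup K (Matrix.diagonal ![1, 1, (algebraMap (NumberField.maximalRealSubfield K) K) a])} (hw : (w : GL (Fin 3) K) = signInvolutionGL) :
    (∀ v, heckeFamilyOf hQ _ _ k hD hDm inst w (heckeFamilyOf hQ _ _ k hD hDm inst w v) = v) ∧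
      ∀ {v : PeterssonSpace hQ (shimuraLevelSubgroup K (Matrix.diagonal ![1, 1, (algebraMap (NumberField.maximalRealSubfield K) K) a]) 𝔪 N)
          (shimuraLevelSubgroup_subset_unitaryGroup (Matrix.diagonal ![1, 1, (algebraMap (NumberField.maximalRealSubfield K) K) a]) 𝔪 N) k hD}, v ≠ 0 →
        ∀ {μ : ℂ}, heckeFamilyOf hQ _ _ k hD hDm inst w v = μ • v → μ = 1 ∨ μ = -1 := by
  have hnorm : ∀ s : GL (Fin 3) K, s ∈ shimuraLevelSubgroup K (Matrix.diagonal ![1, 1, (algebraMap (NumberField.maximalRealSubfield K) K) a]) 𝔪 N ↔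
      (w : GL (Fin 3) K) * s * (w : GL (Fin 3) K)⁻¹ ∈ shimuraLevelSubgroup K (Matrix.diagonal ![1, 1, (algebraMap (NumberField.maximalRealSubfield K) K) a]) 𝔪 N := by
    rw [hw]; exact signInvolutionGL_normalizes_shimuraLevel_diagonal a hcoord N
  have hw2 : (w : GL (Fin 3) K) * w = 1 := by rw [hw]; exact signInvolutionGL_mul_self
  exact ⟨heckeFamilyOf_heckeFamilyOf_eq_self_of_normalizes_of_sq_eq_one hQ _ _ k hD hDm inst hnorm hw2,
    fun {_v} hv {_μ} hμ => heckeFamilyOf_eigenvalue_eq_one_or_neg_one_of_normalizes_of_sq_eq_one hQ _ _ k hD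
      hDm inst hnorm hw2 hv hμ⟩

end Summit.Ventures.HodgeRepro2.ShimuraData
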